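import Summits.RiemannHypothesis.RiemannHypothesis.Theorems.PfPersistenceM2EvenSectorCosineFactor
import Summits.RiemannHypothesis.RiemannHypothesis.Theorems.WeilWindowFlowStrictUnderRHZeroSide
import Summits.RiemannHypothesis.RiemannHypothesis.Theorems.WeilGroundStateGroundStatesConvergeToXiLineExactWeak
import Mathlib.Analysis.Distribution.SchwartzSpace.Fourier
import Mathlib.Analysis.Fourier.FourierTransformDeriv
import Mathlib.Analysis.Fourier.Inversion
import HarnessLib

/-!
# Persistence programme, M2 even sector — the cosine product (pub-rhpf cell, M2 seat, gen 7)

Long-odds MECHANISM SEARCH; **no RH claims**.  RH-free, kernel-checked.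

Sequel to `…CosineFactor.lean`.  For a sequence `ρ₀, ρ₁, …` in the upper half-plane with
`∑ 1/Im ρₖ < ∞`, the even real tests `φ_K = phiSeq ρ K` of the prequel converge to an even real
Weil test function `φ = phiLim ρ`, supported in `[-R, R]`, `R = 1 + π ∑ 1/Im ρₖ`, whose
Weil–Mellin transform vanishes at EVERY `ρₖ` and equals `∫ cosSeed > 0` at `1/2`
(`exists_evenRealTest_weilMellin_vanish_of_summable`, and a set version).  The limit is taken
on the Fourier side: `𝓕 φ_K = (∏_{k<K} lineFactor_k) · 𝓕 cosSeed` with factors in `[0, 1]`, so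
`𝓕 φ_K → G` monotonically and dominatedly (`|𝓕 cosSeed|` is Schwartz); `φ := 𝓕 G` is smooth
(`Real.contDiff_fourier`), `φ_K = 𝓕 𝓕 φ_K → φ` pointwise (Fourier inversion + evenness +
dominated convergence), so `φ` inherits evenness, reality and the common support bound, and
`φ_K^(s) → φ^(s)` for every `s` (dominated convergence on `[-R, R]`).

The sequel `…SummableMultiplier.lean` derives `(SUM_θ) ⇒ QuadrantMultiplier θ` for the
quadrant of non-trivial zeros and the sharpened trichotomy.

All statements are [folklore] analysis; nothing on RH is claimed.
-/

noncomputable section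
set_option linter.dupNamespace false

open Complex Filter Set MeasureTheory
open scoped Real Topology ContDiff FourierTransform SchwartzMap

namespace Summit.RiemannHypothesis.RiemannHypothesis.Theorems.PfPersistenceM2NegIndex.CosineProduct

open Literature.NumberTheory.LFunctions
open Literature.NumberTheory.LFunctions.ZetaZeros

variable {ρ : ℕ → ℂ}

/-! ## 0. Bounds for the finite stage -/

/-- `0 ≤ lineProd K y`. -/
theorem lineProd_nonneg (K : ℕ) (y : ℝ) : 0 ≤ lineProd ρ K y :=
  Finset.prod_nonneg fun k _ ↦ threePointLine_nonneg (cosWeight_pos (ρ k)).le _ _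

/-- `lineProd K y ≤ 1`. -/
theorem lineProd_le_one (K : ℕ) (y : ℝ) : lineProd ρ K y ≤ 1 :=
  Finset.prod_le_one (fun k _ ↦ threePointLine_nonneg (cosWeight_pos (ρ k)).le _ _)
    fun k _ ↦ threePointLine_le_one (cosWeight_pos (ρ k)).le _ _

/-- `K ↦ lineProd K y` is non-increasing (each factor lies in `[0, 1]`). [folklore] -/
theorem lineProd_antitone (y : ℝ) : Antitone fun K ↦ lineProd ρ K y := by
  refine antitone_nat_of_succ_le fun K ↦ ?_
  show lineProd ρ (K + 1) y ≤ lineProd ρ K y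
  rw [lineProd, Finset.prod_range_succ, ← lineProd]
  exact mul_le_of_le_one_right (lineProd_nonneg K y)
    (threePointLine_le_one (cosWeight_pos (ρ K)).le _ _)

/-- `suppRadius K = 1 + π ∑_{k<K} 1/Im ρ_k`. [folklore] -/
theorem suppRadius_eq (K : ℕ) : suppRadius ρ K = 1 + π * ∑ k ∈ Finset.range K, 1 / (ρ k).im := by
  unfold suppRadius halfPeriod
  rw [Finset.mul_sum]
  congr 1
  exact Finset.sum_congr rfl fun k _ ↦ by ring

/-- Under `∑ 1/Im ρ_k < ∞` the supports stay in one interval: `suppRadius K ≤ 1 + π ∑' 1/Im ρ_k`.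
[folklore] -/
theorem suppRadius_le (him : ∀ k, 0 < (ρ k).im) (hsum : Summable fun k ↦ 1 / (ρ k).im) (K : ℕ) :
    suppRadius ρ K ≤ 1 + π * ∑' k, 1 / (ρ k).im := by
  rw [suppRadius_eq]
  gcongr
  exact hsum.sum_le_tsum _ fun k _ ↦ (one_div_pos.mpr (him k)).le

/-! ## 1. The Fourier side of the finite stage -/

-- `𝓕 g w = ĝ(1/2 - 2πi w)` is `WeilWindowFlowStrictUnderRH.fourier_eq_weilMellin`; integrability of
-- `𝓕 g` for a Weil test `g` is `GroundStatesConvergeToXi.integrable_fourier_of_isWeilTest`.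

/-- `𝓕 φ_K = lineProd K (-2π ·) · 𝓕 cosSeed`. [folklore] -/
theorem fourier_phiSeq (him : ∀ k, 0 < (ρ k).im) (K : ℕ) (w : ℝ) :
    𝓕 (phiSeq ρ K) w = (lineProd ρ K (-(2 * π * w)) : ℂ) * 𝓕 cosSeed w := by
  rw [WeilWindowFlowStrictUnderRH.fourier_eq_weilMellin,
    WeilWindowFlowStrictUnderRH.fourier_eq_weilMellin, weilMellin_phiSeq_line him]

/-- `‖𝓕 φ_K‖ ≤ ‖𝓕 cosSeed‖` pointwise, uniformly in `K`. [folklore] -/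
theorem norm_fourier_phiSeq_le (him : ∀ k, 0 < (ρ k).im) (K : ℕ) (w : ℝ) :
    ‖𝓕 (phiSeq ρ K) w‖ ≤ ‖𝓕 cosSeed w‖ := by
  rw [fourier_phiSeq him, norm_mul, Complex.norm_real, Real.norm_of_nonneg (lineProd_nonneg _ _)]
  exact mul_le_of_le_one_left (norm_nonneg _) (lineProd_le_one _ _)

/-- `φ_K = 𝓕 (𝓕 φ_K)` pointwise (Fourier inversion `𝓕⁻ 𝓕 φ_K = φ_K` for the continuous
integrable `φ_K` with integrable transform, and evenness `𝓕⁻ h (-t) = 𝓕 h (t)`). [folklore] -/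
theorem phiSeq_eq_fourier_fourier (him : ∀ k, 0 < (ρ k).im) (K : ℕ) (t : ℝ) :
    phiSeq ρ K t = 𝓕 (𝓕 (phiSeq ρ K)) t := by
  have hc : Continuous (phiSeq ρ K) := (phiSeq_contDiff ρ K).continuous
  have hinv := hc.fourierInv_fourier_eq
    (hc.integrable_of_hasCompactSupport (phiSeq_hasCompactSupport him K))
    (GroundStatesConvergeToXi.integrable_fourier_of_isWeilTest (isWeilTest_phiSeq him K))
  rw [← phiSeq_even ρ K t, ← congrFun hinv (-t), Real.fourierInv_eq_fourier_neg, neg_neg]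

/-! ## 2. The cosSeed as a Schwartz function -/

/-- The cosSeed has compact support. -/
theorem cosSeed_hasCompactSupport : HasCompactSupport cosSeed :=
  cosSeedBump.hasCompactSupport.comp_left Complex.ofReal_zero

/-- The cosSeed as a Schwartz function (so `𝓕 cosSeed` is Schwartz). -/
def cosSeedS : 𝓢(ℝ, ℂ) := cosSeed_hasCompactSupport.toSchwartzMap cosSeed_contDiff

/-- `𝓕 cosSeedS` is `𝓕 cosSeed` as a function. -/
theorem coe_fourier_cosSeedS : ((𝓕 cosSeedS : 𝓢(ℝ, ℂ)) : ℝ → ℂ) = 𝓕 cosSeed := rfl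

/-- `𝓕 cosSeed` is integrable. -/
theorem integrable_fourier_cosSeed : Integrable (𝓕 cosSeed) := by
  rw [← coe_fourier_cosSeedS]
  exact SchwartzMap.integrable (μ := volume) _

/-- `‖w‖ⁿ ‖𝓕 cosSeed w‖` is integrable for every `n` (Schwartz decay). -/
theorem integrable_pow_mul_fourier_cosSeed (n : ℕ) :
    Integrable fun w : ℝ ↦ ‖w‖ ^ n * ‖𝓕 cosSeed w‖ := by
  rw [← coe_fourier_cosSeedS]
  exact SchwartzMap.integrable_pow_mul volume _ n

/-! ## 3. The limit objects -/

variable (ρ) in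
/-- The limiting line multiplier `P∞(y) = inf_K lineProd K y (= lim_K)`. -/
def linePinf (y : ℝ) : ℝ := ⨅ K, lineProd ρ K y

/-- The products are bounded below (by `0`). -/
theorem bddBelow_lineProd (y : ℝ) : BddBelow (range fun K ↦ lineProd ρ K y) :=
  ⟨0, by rintro _ ⟨K, rfl⟩; exact lineProd_nonneg K y⟩

/-- `lineProd K y → P∞(y)` (monotone convergence). -/
theorem tendsto_lineProd (y : ℝ) :
    Tendsto (fun K ↦ lineProd ρ K y) atTop (𝓝 (linePinf ρ y)) :=
  tendsto_atTop_ciInf (lineProd_antitone y) (bddBelow_lineProd y)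

/-- `0 ≤ P∞`. -/
theorem linePinf_nonneg (y : ℝ) : 0 ≤ linePinf ρ y := le_ciInf fun K ↦ lineProd_nonneg K y

/-- `P∞ ≤ 1`. -/
theorem linePinf_le_one (y : ℝ) : linePinf ρ y ≤ 1 :=
  (ciInf_le (bddBelow_lineProd y) 0).trans (lineProd_le_one 0 y)

variable (ρ) in
/-- The Fourier transform of the limit: `G(w) = P∞(-2πw) · (𝓕 cosSeed)(w)`. -/
def fourierLim (w : ℝ) : ℂ := (linePinf ρ (-(2 * π * w)) : ℂ) * 𝓕 cosSeed w

variable (ρ) in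
/-- **The limit test function** `φ = 𝓕 G`. -/
def phiLim : ℝ → ℂ := 𝓕 (fourierLim ρ)

/-- `𝓕 φ_K → G` pointwise. -/
theorem tendsto_fourier_phiSeq (him : ∀ k, 0 < (ρ k).im) (w : ℝ) :
    Tendsto (fun K ↦ 𝓕 (phiSeq ρ K) w) atTop (𝓝 (fourierLim ρ w)) := by
  have e : (fun K ↦ 𝓕 (phiSeq ρ K) w) = fun K ↦ (lineProd ρ K (-(2 * π * w)) : ℂ) * 𝓕 cosSeed w :=
    funext fun K ↦ fourier_phiSeq him K w
  rw [e]
  exact ((tendsto_lineProd (-(2 * π * w))).ofReal).mul_const _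

/-- `‖G‖ ≤ ‖𝓕 cosSeed‖`. -/
theorem norm_fourierLim_le (w : ℝ) : ‖fourierLim ρ w‖ ≤ ‖𝓕 cosSeed w‖ := by
  rw [fourierLim, norm_mul, Complex.norm_real, Real.norm_of_nonneg (linePinf_nonneg _)]
  exact mul_le_of_le_one_left (norm_nonneg _) (linePinf_le_one _)

/-- `G` is (a.e. strongly) measurable, as a pointwise limit. -/
theorem aestronglyMeasurable_fourierLim (him : ∀ k, 0 < (ρ k).im) :
    AEStronglyMeasurable (fourierLim ρ) volume :=
  aestronglyMeasurable_of_tendsto_ae atTop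
    (fun K ↦ (GroundStatesConvergeToXi.integrable_fourier_of_isWeilTest (isWeilTest_phiSeq him K)).aestronglyMeasurable)
    (Eventually.of_forall fun w ↦ tendsto_fourier_phiSeq him w)

/-- **`φ` is smooth**: `G` is dominated by the Schwartz function `|𝓕 cosSeed|`, so `‖w‖ⁿ G` is
integrable for every `n` (`Real.contDiff_fourier`). [folklore] -/
theorem phiLim_contDiff (him : ∀ k, 0 < (ρ k).im) : ContDiff ℝ ∞ (phiLim ρ) := by
  unfold phiLim
  refine Real.contDiff_fourier (N := (⊤ : ℕ∞)) fun n _ ↦ ?_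
  refine (integrable_pow_mul_fourier_cosSeed n).mono' ?_ (Eventually.of_forall fun w ↦ ?_)
  · exact (continuous_norm.pow n).aestronglyMeasurable.mul
      (aestronglyMeasurable_fourierLim him).norm
  · rw [Real.norm_of_nonneg (by positivity)]
    exact mul_le_mul_of_nonneg_left (norm_fourierLim_le w) (by positivity)

/-- **Pointwise convergence `φ_K(t) → φ(t)`** (dominated convergence on the Fourier side,
dominating function `|𝓕 cosSeed|`). [folklore] -/
theorem tendsto_phiSeq (him : ∀ k, 0 < (ρ k).im) (t : ℝ) :
    Tendsto (fun K ↦ phiSeq ρ K t) atTop (𝓝 (phiLim ρ t)) := by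
  have e : (fun K ↦ phiSeq ρ K t) =
      fun K ↦ ∫ v : ℝ, cexp (↑(-2 * π * v * t) * I) • 𝓕 (phiSeq ρ K) v := by
    funext K
    rw [phiSeq_eq_fourier_fourier him K t, Real.fourier_real_eq_integral_exp_smul]
  rw [e, phiLim, Real.fourier_real_eq_integral_exp_smul]
  refine tendsto_integral_of_dominated_convergence (fun v ↦ ‖𝓕 cosSeed v‖) ?_
    integrable_fourier_cosSeed.norm ?_ ?_
  · intro K
    exact (by fun_prop : Continuous fun v : ℝ ↦ cexp (↑(-2 * π * v * t) * I)).aestronglyMeasurable.smul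
      (GroundStatesConvergeToXi.integrable_fourier_of_isWeilTest (isWeilTest_phiSeq him K)).aestronglyMeasurable
  · intro K
    refine Eventually.of_forall fun v ↦ ?_
    rw [norm_smul, show (((-2 * π * v * t : ℝ) : ℂ) * I) = ((-2 * π * v * t : ℝ) : ℂ) * I from rfl,
      Complex.norm_exp_ofReal_mul_I, one_mul]
    exact norm_fourier_phiSeq_le him K v
  · exact Eventually.of_forall fun v ↦ (tendsto_fourier_phiSeq him v).const_smul _

/-- **`φ_K^(s) → φ^(s)`** for every `s` (dominated convergence on `[-R, R]`,
`R = 1 + π ∑ 1/Im ρₖ`, which contains every support; `‖φ_K‖ ≤ 1`). [folklore] -/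
theorem tendsto_weilMellin_phiSeq (him : ∀ k, 0 < (ρ k).im)
    (hsum : Summable fun k ↦ 1 / (ρ k).im) (s : ℂ) :
    Tendsto (fun K ↦ weilMellin (phiSeq ρ K) s) atTop (𝓝 (weilMellin (phiLim ρ) s)) := by
  set R : ℝ := 1 + π * ∑' k, 1 / (ρ k).im
  have hzero : ∀ K t, R < |t| → phiSeq ρ K t = 0 := fun K t ht ↦
    phiSeq_eq_zero him K t ((suppRadius_le him hsum K).trans_lt ht)
  unfold weilMellin
  refine tendsto_integral_of_dominated_convergence
    (fun t ↦ (Icc (-R) R).indicator (fun t : ℝ ↦ ‖cexp ((s - 1 / 2) * t)‖) t) ?_ ?_ ?_ ?_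
  · intro K
    exact ((phiSeq_contDiff ρ K).continuous.mul (by fun_prop)).aestronglyMeasurable
  · exact ((by fun_prop : Continuous fun t : ℝ ↦ ‖cexp ((s - 1 / 2) * t)‖).integrableOn_Icc).integrable_indicator
      measurableSet_Icc
  · intro K
    refine Eventually.of_forall fun t ↦ ?_
    by_cases ht : t ∈ Icc (-R) R
    · rw [indicator_of_mem ht, norm_mul]
      exact mul_le_of_le_one_left (norm_nonneg _) (norm_phiSeq_le ρ K t)
    · have hlt : R < |t| := by
        rw [mem_Icc, not_and_or, not_le, not_le] at ht
        exact ht.elim (fun h ↦ lt_abs.mpr (Or.inr (by linarith))) fun h ↦ lt_abs.mpr (Or.inl h)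
      rw [indicator_of_notMem ht, hzero K t hlt, zero_mul, norm_zero]
  · exact Eventually.of_forall fun t ↦ (tendsto_phiSeq him t).mul_const _

/-! ## 4. Properties of the limit -/

/-- `φ` is even. -/
theorem phiLim_even (him : ∀ k, 0 < (ρ k).im) (t : ℝ) : phiLim ρ (-t) = phiLim ρ t := by
  have h1 := tendsto_phiSeq him (-t)
  simp only [phiSeq_even] at h1
  exact tendsto_nhds_unique h1 (tendsto_phiSeq him t)

/-- `φ` is real-valued. -/
theorem phiLim_im (him : ∀ k, 0 < (ρ k).im) (t : ℝ) : (phiLim ρ t).im = 0 := by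
  refine tendsto_nhds_unique ((Complex.continuous_im.tendsto _).comp (tendsto_phiSeq him t)) ?_
  simp only [Function.comp_def, phiSeq_im]
  exact tendsto_const_nhds

/-- `φ = 0` off `[-R, R]`. -/
theorem phiLim_eq_zero (him : ∀ k, 0 < (ρ k).im) (hsum : Summable fun k ↦ 1 / (ρ k).im)
    (t : ℝ) (ht : 1 + π * ∑' k, 1 / (ρ k).im < |t|) : phiLim ρ t = 0 := by
  refine tendsto_nhds_unique (tendsto_phiSeq him t) ?_
  have : (fun K ↦ phiSeq ρ K t) = fun _ ↦ 0 :=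
    funext fun K ↦ phiSeq_eq_zero him K t ((suppRadius_le him hsum K).trans_lt ht)
  rw [this]
  exact tendsto_const_nhds

/-- `supp φ ⊆ [-R, R]`, `R = 1 + π ∑ 1/Im ρₖ`. [folklore] -/
theorem tsupport_phiLim_subset (him : ∀ k, 0 < (ρ k).im)
    (hsum : Summable fun k ↦ 1 / (ρ k).im) :
    tsupport (phiLim ρ) ⊆
      Icc (-(1 + π * ∑' k, 1 / (ρ k).im)) (1 + π * ∑' k, 1 / (ρ k).im) := by
  refine closure_minimal (fun t ht ↦ ?_) isClosed_Icc
  by_contra h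
  rw [mem_Icc, not_and_or, not_le, not_le] at h
  exact ht (phiLim_eq_zero him hsum t
    (h.elim (fun h ↦ lt_abs.mpr (Or.inr (by linarith))) fun h ↦ lt_abs.mpr (Or.inl h)))

/-- `φ` has compact support. -/
theorem phiLim_hasCompactSupport (him : ∀ k, 0 < (ρ k).im)
    (hsum : Summable fun k ↦ 1 / (ρ k).im) : HasCompactSupport (phiLim ρ) :=
  isCompact_Icc.of_isClosed_subset (isClosed_tsupport _) (tsupport_phiLim_subset him hsum)

/-- `φ` is a Weil test function. -/
theorem isWeilTest_phiLim (him : ∀ k, 0 < (ρ k).im) (hsum : Summable fun k ↦ 1 / (ρ k).im) :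
    IsWeilTest (phiLim ρ) :=
  ⟨phiLim_contDiff him, phiLim_hasCompactSupport him hsum⟩

/-- **`φ^(ρₖ) = 0` for every `k`** (`φ_K^(ρₖ) = 0` for `K > k`, and `φ_K^ → φ^`). [folklore] -/
theorem weilMellin_phiLim_eq_zero (him : ∀ k, 0 < (ρ k).im)
    (hsum : Summable fun k ↦ 1 / (ρ k).im) (k : ℕ) : weilMellin (phiLim ρ) (ρ k) = 0 := by
  refine tendsto_nhds_unique (tendsto_weilMellin_phiSeq him hsum (ρ k)) ?_
  refine tendsto_const_nhds.congr' ?_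
  filter_upwards [eventually_gt_atTop k] with K hK
  exact (weilMellin_phiSeq_eq_zero him hK).symm

/-- **`φ^(1/2) = cosSeed^(1/2) ≠ 0`**. [folklore] -/
theorem weilMellin_phiLim_half (him : ∀ k, 0 < (ρ k).im)
    (hsum : Summable fun k ↦ 1 / (ρ k).im) :
    weilMellin (phiLim ρ) (1 / 2) = weilMellin cosSeed (1 / 2) := by
  refine tendsto_nhds_unique (tendsto_weilMellin_phiSeq him hsum (1 / 2)) ?_
  simp only [weilMellin_phiSeq_half him]
  exact tendsto_const_nhds

/-- **COSINE-PRODUCT THEOREM (PROVED, RH-free).**  For any sequence `ρₖ` with `Im ρₖ > 0` and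
`∑ 1/Im ρₖ < ∞` there is an even, real-valued Weil test function, supported in a symmetric
interval, whose Weil–Mellin transform is non-zero at `1/2` and vanishes at every `ρₖ`.
(Paley–Wiener-closure-theorem shape; no hypothesis on `Re ρₖ`.) [folklore] -/
theorem exists_evenRealTest_weilMellin_vanish_of_summable (ρ : ℕ → ℂ)
    (him : ∀ k, 0 < (ρ k).im) (hsum : Summable fun k ↦ 1 / (ρ k).im) :
    ∃ φ : ℝ → ℂ, ∃ b : ℝ, IsWeilTest φ ∧ (∀ t, φ (-t) = φ t) ∧ (∀ t, (φ t).im = 0) ∧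
      tsupport φ ⊆ Icc (-b) b ∧ weilMellin φ (1 / 2) ≠ 0 ∧ ∀ k, weilMellin φ (ρ k) = 0 :=
  ⟨phiLim ρ, _, isWeilTest_phiLim him hsum, phiLim_even him, phiLim_im him,
    tsupport_phiLim_subset him hsum,
    by rw [weilMellin_phiLim_half him hsum]; exact weilMellin_cosSeed_half_ne_zero,
    weilMellin_phiLim_eq_zero him hsum⟩

/-- **Set version.**  For an infinite set `Z` in the upper half-plane over which the (positive)
family `1/Im ρ` is summable — so `Z` is countable; enumerate it bijectively — one even real test
function annihilates all of `Z`. [folklore] -/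
theorem exists_evenRealTest_weilMellin_vanish_of_summable_set {Z : Set ℂ}
    (hZ : ∀ ρ ∈ Z, 0 < ρ.im) (hinf : Z.Infinite)
    (hsum : Summable fun ρ : ↥Z ↦ 1 / (ρ : ℂ).im) :
    ∃ φ : ℝ → ℂ, ∃ b : ℝ, IsWeilTest φ ∧ (∀ t, φ (-t) = φ t) ∧ (∀ t, (φ t).im = 0) ∧
      tsupport φ ⊆ Icc (-b) b ∧ weilMellin φ (1 / 2) ≠ 0 ∧ ∀ ρ ∈ Z, weilMellin φ ρ = 0 := by
  have hcZ : Countable ↥Z := by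
    have h := hsum.countable_support
    rw [show (Function.support fun ρ : ↥Z ↦ 1 / (ρ : ℂ).im) = univ from
      eq_univ_of_forall fun ρ ↦ (one_div_pos.mpr (hZ ρ ρ.2)).ne', countable_univ_iff] at h
    exact h
  haveI : Infinite ↥Z := infinite_coe_iff.mpr hinf
  obtain ⟨_⟩ := nonempty_denumerable ↥Z
  obtain ⟨e⟩ : Nonempty (ℕ ≃ ↥Z) := ⟨(Denumerable.eqv ↥Z).symm⟩
  have hsum' : Summable ((fun ρ : ↥Z ↦ 1 / (ρ : ℂ).im) ∘ e) := e.summable_iff.mpr hsum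
  obtain ⟨φ, b, hφ, hev, hre, hφs, hne, hvan⟩ :=
    exists_evenRealTest_weilMellin_vanish_of_summable (fun k ↦ (e k : ℂ))
      (fun k ↦ hZ _ (e k).2) hsum'
  refine ⟨φ, b, hφ, hev, hre, hφs, hne, fun ρ hρ ↦ ?_⟩
  have h := hvan (e.symm ⟨ρ, hρ⟩)
  rwa [Equiv.apply_symm_apply] at h

end Summit.RiemannHypothesis.RiemannHypothesis.Theorems.PfPersistenceM2NegIndex.CosineProduct
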